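/-
Copyright (c) 2026 the pub-hodgecm-mathlib formalisation cell (harness21).  Prover seat hodgecm-mathlib-F0P2-p02 (g27); E1 keeper ∕ dealer F0P3a-p03 (g31), E1 BRICK LEDGER row 68-R
«`hrank` AT THE DATUM» (k70, 2026-09-03T06:00:23Z; consumer = row 68-H, the K4′-UNR assembly).
-/
import Literature.NumberTheory.Rogawski1990.TypeThreeCubicTorusNonsplit        -- ★ `TypeThreeTorus.exists_uniformizer`, `placeForm_qsForm_eq` (brings ★ `CMLocalNonsplitBorelTransport`: `localNonsplitEquiv_mem_torusU_iff`)
import Literature.NumberTheory.Automorphic.UnitaryGroupSplitTorusRankOneThree   -- ★ (T2) `exists_splitTorus_generator_local_of_nonsplit_three_of_involution`, `mem_unitaryGroupOfForm_of_eq_diagonal_three`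
import Literature.NumberTheory.Automorphic.ValuedFieldValuativeRelBridge         -- ★ `isDiscreteValuationRing_integer_of_compatible`, `isUniformizingElement_of_v_eq`
import Literature.NumberTheory.Automorphic.CMTorusRegularAEPrelims               -- ★ `isClosed_torusU_of_t1Space`
import Literature.Topology.Algebra.LocallyConstantAdditiveCompact               -- ★ LC-ADDITIVE `eq_zero_on_compact_of_eq_zero_on_open`, `additive_map_pow`, `torsionFree_of_charZero`
import Literature.NumberTheory.Automorphic.CMBorelWeylTorusConjugate              -- (ED. 2) ★ T3b `weylConj_mem_cmTorus`, `unitModulusChar_torusEntry_zero_weylConj` (`‖(ʷt)₀₀‖ = ‖t₀₀‖⁻¹`)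
import Literature.NumberTheory.Automorphic.CMBorelAdmissibleTorusRay               -- (ED. 2) ★ `exists_torus_coe_localNonsplitEquiv_eq_diagonal`, `unitModulusChar_torusEntry_lt_one_of_coe_localNonsplitEquiv_eq_diagonal` (the ray `‖b₀₀‖ < 1`)
import Literature.NumberTheory.Automorphic.CMLocalRingModulusContinuous           -- (ED. 2) ★ `isOpen_setOf_forall_v_eq_one` (+ ★ `unitModulusChar_eq_one_of_forall_v_eq_one`)
import Literature.NumberTheory.Automorphic.CMPrincipalSeriesJacquetEvalOne          -- (ED. 2) ★ `continuous_torusEntry`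
import HarnessLib

/-!
# The locally-zero additive characters of the diagonal torus `T(L⁺_v) ≤ U(Φ₃)(L⁺_v)` at a NON-SPLIT place form ONE LINE («`hrank` at the datum»)

Cell `pub/hodgecm-mathlib`, crux H413 = `stmt-HodgeConjecture-24833` (`--supports` lane, helper, THEOREMS ONLY: no definition ∕ instance ∕ notation ∕ named fact ∕ `sorry`).
Namespace `Summit.HodgeConjecture.HodgeConjecture.Cruxes.H413.F0P3cStCharTSAdditiveCharLine`.  E1 BRICK LEDGER row 68-R: the discharge, at `t := cmBorelTriple L 3 v` for a
non-split `v`, of the binder `hrank : ∀ β : ↥t.M → ℂ, (∀ m m', β (m * m') = β m + β m') → (∃ U : Subgroup ↥t.M, IsOpen (U : Set ↥t.M) ∧ ∀ m ∈ U, β m = 0) → ∃ c, ∀ m,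
β m = c * lam m` of ★ (O1) `F0P3cStCharTSK4PrimeJetIntertwiner.exists_jetIntertwiner_of_openCellJet` («additive rank one of `M`»), for every additive `lam` that is zero on an open
subgroup and not identically zero (the occurring additive character of the K4′ cell).  Seat F0P2-p02 (g27).

THE MATHEMATICS.  `T = {d(α, β, ᾱ⁻¹)} ≅ L_w^× × L_w^1` (Rogawski (1990) §1.10; `v` non-split, `w` the place above it) is `ℤ`-BY-COMPACT: by ★ (T2)
`exists_splitTorus_generator_local_of_nonsplit_three_of_involution` (applied to the regular diagonal element `γ = e⁻¹ diag(ϖ⁻¹, 1, σ_w ϖ)`, `ϖ` a uniformiser of `L_w`, `e` the one-place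
model ★ `localNonsplitEquiv`) there is `τ ∈ T` such that every `t ∈ T` (which centralises `γ` since `T` is abelian) satisfies `t · τ^{−n} ∈ K` for some `n ∈ ℤ` and some COMPACT subgroup `K`
(traced on the closed subgroup `T`, ★ `isClosed_torusU_of_t1Space`) — **`exists_generator_mod_compact`**.  An additive `β : T → ℂ` vanishing on an open subgroup vanishes on every
compact subgroup (★ LC-ADDITIVE `eq_zero_on_compact_of_eq_zero_on_open`, `ℂ` torsion-free), hence `β t = n · β τ` with the SAME `n` for every such `β`
(**`additive_eq_zsmul_generator`**); so two of them are proportional as soon as one is non-zero: **`additive_eq_mul_of_eq_zero_on_open`** — «the smooth additive characters of `T(L⁺_v)`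
form the line `ℂ · ord_w`» ([Tits1979, §1.2]: `Z = A · Z_c` for the split component of a torus; [Brown1982, Ch. III §1 Ex. 2]: an additive map factors through `T ∕ T_c ≅ ℤ`).
[cite: Tits1979, §1.2 pp. 31–32] [cite: Rogawski1990, §1.10 p. 9; §3.6 p. 31] [cite: Brown1982, Ch. III §1 Exercise 2 p. 60] [cite: BourbakiGT1, Ch. III §2 no. 1]
HONEST LABEL: count-neutral datum helper (one call in row 68-H); E1 = PRINT; h413 OPEN; HC_CM is proved only modulo the 7 printed citations (2 remaining named inputs hLiu418 =
stmt-HodgeConjecture-24832, h413 = stmt-HodgeConjecture-24833) until rung 0 closes.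

## References
* [Tits1979] J. Tits, *Reductive groups over local fields*, PSPM 33.1 (1979), §1.2 pp. 31–32.
* [Rogawski1990] J. D. Rogawski, *Automorphic Representations of Unitary Groups in Three Variables*, Ann. of Math. Stud. 123 (1990), §1.10 p. 9, §3.6 p. 31.
* [Brown1982] K. S. Brown, *Cohomology of Groups*, GTM 87 (1982), Ch. III §1 Exercise 2 p. 60.
* [BourbakiGT1] N. Bourbaki, *General Topology*, Ch. III §2 no. 1.
-/

set_option autoImplicit false

set_option linter.dupNamespace false

noncomputable section

open scoped MatrixGroups
open Matrix NumberField IsDedekindDomain Topology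

namespace Summit.HodgeConjecture.HodgeConjecture.Cruxes.H413.F0P3cStCharTSAdditiveCharLine

open Literature.NumberTheory.Automorphic Literature.NumberTheory.Automorphic.UnitaryGroup Literature.NumberTheory.GaloisRepresentations
open Literature.NumberTheory.Rogawski1990

variable (L : Type) [Field L] [NumberField L] [IsCMField L] (v : HeightOneSpectrum (𝓞 ↥(maximalRealSubfield L)))
  (w : PlacesOver L v) (hw : IsCMField.complexConj L • w.1 = w.1)

/-! ## §1 `T(L⁺_v)` is `ℤ`-by-compact at a non-split place -/

set_option maxHeartbeats 400000 in
include hw in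
/-- **`T(L⁺_v)` IS `ℤ`-BY-COMPACT** (`v` non-split): there is `τ ∈ T = (cmBorelTriple L 3 v).M` such that for every `t ∈ T` some `t · τ^{−n}` (`n ∈ ℤ`) lies in a COMPACT subgroup of
`T`.  (★ (T2) at the regular diagonal `γ = e⁻¹ diag(ϖ⁻¹, 1, σ_w ϖ)`; `T` is abelian so `T ≤ Z(γ)`; the compact subgroup of `Z(γ)` is traced on the closed subgroup `T`.)  Budget
`maxHeartbeats 400000` (2× default; measured: the file elaborates in ≈ 13 s — one tactic block over the CM carriers, ★ (T2)'s own precedent). [cite: Tits1979, §1.2 pp. 31–32] [cite: Rogawski1990, §1.10 p. 9; §3.6 p. 31] -/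
theorem exists_generator_mod_compact :
    ∃ τ : ↥(cmBorelTriple L 3 v).M, ∀ t : ↥(cmBorelTriple L 3 v).M, ∃ (n : ℤ) (K : Subgroup ↥(cmBorelTriple L 3 v).M),
      IsCompact (K : Set ↥(cmBorelTriple L 3 v).M) ∧ t * (τ ^ n)⁻¹ ∈ K := by
  -- the uniformiser of `L_w` and the one-place data
  obtain ⟨ϖ, hvϖ, hvσϖ⟩ := TypeThreeTorus.exists_uniformizer L w hw
  haveI := isDiscreteValuationRing_integer_of_compatible hvϖ
  have hϖu : IsUniformizingElement ϖ := isUniformizingElement_of_v_eq hvϖ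
  have hϖ0 : ϖ ≠ 0 := fun h => by
    rw [h, map_zero] at hvϖ
    exact WithZero.exp_ne_zero hvϖ.symm
  have hσσ : ∀ x : w.1.adicCompletion L, galAdicCompletionMap (L := L) (IsCMField.complexConj L) hw
      (galAdicCompletionMap (L := L) (IsCMField.complexConj L) hw x) = x :=
    galAdicCompletionMap_galAdicCompletionMap_of_smul_eq (IsCMField.complexConj L) w (IsCMField.complexConj_ne_one L) hw
  have hform := TypeThreeTorus.placeForm_qsForm_eq L w
  have hJ : ∀ i j : Fin 3, j ≠ Fin.rev i → placeForm (qsForm L) w.1 i j = 0 := by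
    intro i j hij
    rw [hform]
    fin_cases i <;> fin_cases j <;> first | rfl | exact absurd (by decide) hij
  have hJ₀₂ : placeForm (qsForm L) w.1 0 2 ≠ 0 := by rw [hform]; exact one_ne_zero
  have hJ₁₁ : placeForm (qsForm L) w.1 1 1 ≠ 0 := by rw [hform]; exact one_ne_zero
  -- the regular diagonal `γ = e⁻¹ diag(ϖ⁻¹, 1, σ_w ϖ)`
  have hd0 : ∀ i, (![ϖ⁻¹, 1, galAdicCompletionMap (L := L) (IsCMField.complexConj L) hw ϖ] : Fin 3 → w.1.adicCompletion L) i ≠ 0 := by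
    intro i
    fin_cases i
    · exact inv_ne_zero hϖ0
    · exact one_ne_zero
    · exact (map_ne_zero _).2 hϖ0
  set γU : GL (Fin 3) (w.1.adicCompletion L) := glDiagonal 3 (w.1.adicCompletion L) fun i =>
    Units.mk0 ((![ϖ⁻¹, 1, galAdicCompletionMap (L := L) (IsCMField.complexConj L) hw ϖ] : Fin 3 → w.1.adicCompletion L) i) (hd0 i) with hγUdef
  have hγUt : (γU : Matrix (Fin 3) (Fin 3) (w.1.adicCompletion L)) =
      diagonal ![ϖ⁻¹, 1, galAdicCompletionMap (L := L) (IsCMField.complexConj L) hw ϖ] := by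
    rw [hγUdef, coe_glDiagonal]; rfl
  have hγUmem : γU ∈ unitaryGroupOfForm (galAdicCompletionMap (L := L) (IsCMField.complexConj L) hw) (placeForm (qsForm L) w.1) := by
    refine mem_unitaryGroupOfForm_of_eq_diagonal_three _ hJ hγUt ?_ ?_ ?_
    · show galAdicCompletionMap (L := L) (IsCMField.complexConj L) hw ϖ⁻¹ * galAdicCompletionMap (L := L) (IsCMField.complexConj L) hw ϖ = 1
      rw [← map_mul, inv_mul_cancel₀ hϖ0, map_one]
    · show galAdicCompletionMap (L := L) (IsCMField.complexConj L) hw 1 * 1 = 1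
      rw [map_one, mul_one]
    · show galAdicCompletionMap (L := L) (IsCMField.complexConj L) hw (galAdicCompletionMap (L := L) (IsCMField.complexConj L) hw ϖ) * ϖ⁻¹ = 1
      rw [hσσ, mul_inv_cancel₀ hϖ0]
  set e := localNonsplitEquiv (IsCMField.complexConj L) (qsForm L) (IsCMField.complexConj_ne_one L) w hw with hedef
  set γ : «local» L (IsCMField.complexConj L) 3 (qsForm L) v := e.symm ⟨γU, hγUmem⟩ with hγdef
  have heγ : e γ = ⟨γU, hγUmem⟩ := e.apply_symm_apply _
  have hγm : (((e γ : ↥(unitaryGroupOfForm (galAdicCompletionMap (L := L) (IsCMField.complexConj L) hw) (placeForm (qsForm L) w.1))) :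
      GL (Fin 3) (w.1.adicCompletion L)) : Matrix (Fin 3) (Fin 3) (w.1.adicCompletion L)) =
        diagonal ![ϖ⁻¹, 1, galAdicCompletionMap (L := L) (IsCMField.complexConj L) hw ϖ] := by
    rw [heγ]; exact hγUt
  -- regularity of `γ`: the three diagonal entries have valuations `exp 1`, `exp 0`, `exp (−1)`
  have hv0 : Valued.v (ϖ⁻¹) = WithZero.exp (1 : ℤ) := by rw [map_inv₀, hvϖ, ← WithZero.exp_neg, neg_neg]
  have hv1 : Valued.v (1 : w.1.adicCompletion L) = WithZero.exp (0 : ℤ) := by rw [map_one, WithZero.exp_zero]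
  have hreg : ∀ i j : Fin 3, i ≠ j → IsUnit ((![ϖ⁻¹, 1, galAdicCompletionMap (L := L) (IsCMField.complexConj L) hw ϖ] : Fin 3 → w.1.adicCompletion L) i -
      (![ϖ⁻¹, 1, galAdicCompletionMap (L := L) (IsCMField.complexConj L) hw ϖ] : Fin 3 → w.1.adicCompletion L) j) := by
    have hne : ∀ a b : w.1.adicCompletion L, ∀ m n : ℤ, Valued.v a = WithZero.exp m → Valued.v b = WithZero.exp n → m ≠ n → IsUnit (a - b) := by
      intro a b m n ha hb hmn
      refine isUnit_iff_ne_zero.2 (sub_ne_zero.2 fun hab => hmn ?_)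
      rw [hab, hb, WithZero.exp_inj] at ha
      exact ha.symm
    intro i j hij
    fin_cases i <;> fin_cases j
    · exact absurd rfl hij
    · exact hne _ _ 1 0 hv0 hv1 (by decide)
    · exact hne _ _ 1 (-1) hv0 hvσϖ (by decide)
    · exact hne _ _ 0 1 hv1 hv0 (by decide)
    · exact absurd rfl hij
    · exact hne _ _ 0 (-1) hv1 hvσϖ (by decide)
    · exact hne _ _ (-1) 1 hvσϖ hv0 (by decide)
    · exact hne _ _ (-1) 0 hvσϖ hv1 (by decide)
    · exact absurd rfl hij
  -- ★ (T2): the generator `τ ∈ Z(γ)` with `e τ = diag(ϖ⁻¹, 1, σ_w ϖ)` and (gen)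
  obtain ⟨τ, hτm, hgen, -⟩ := exists_splitTorus_generator_local_of_nonsplit_three_of_involution (IsCMField.complexConj L)
    (qsForm L) (IsCMField.complexConj_ne_one L) w hw hJ hJ₀₂ hJ₁₁ hϖu hγm hreg
  -- `τ` and `γ` lie in `T` (their one-place images are diagonal)
  have hdiagT : ∀ g : «local» L (IsCMField.complexConj L) 3 (qsForm L) v,
      (((e g : ↥(unitaryGroupOfForm (galAdicCompletionMap (L := L) (IsCMField.complexConj L) hw) (placeForm (qsForm L) w.1))) :
          GL (Fin 3) (w.1.adicCompletion L)) : Matrix (Fin 3) (Fin 3) (w.1.adicCompletion L)) =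
        diagonal ![ϖ⁻¹, 1, galAdicCompletionMap (L := L) (IsCMField.complexConj L) hw ϖ] →
      g ∈ (cmBorelTriple L 3 v).M := by
    intro g hg
    refine (localNonsplitEquiv_mem_torusU_iff L v w hw g).1 ((mem_torusU_iff _).2 ⟨fun i =>
      Units.mk0 ((![ϖ⁻¹, 1, galAdicCompletionMap (L := L) (IsCMField.complexConj L) hw ϖ] : Fin 3 → w.1.adicCompletion L) i) (hd0 i),
        Units.ext ?_⟩)
    rw [coe_glDiagonal, ← hedef, hg]
    rfl
  have hτT : ((τ : ↥(Subgroup.centralizer ({γ} : Set («local» L (IsCMField.complexConj L) 3 (qsForm L) v)))) :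
      «local» L (IsCMField.complexConj L) 3 (qsForm L) v) ∈ (cmBorelTriple L 3 v).M := hdiagT _ hτm
  have hγT : γ ∈ (cmBorelTriple L 3 v).M := hdiagT _ hγm
  refine ⟨⟨_, hτT⟩, fun t => ?_⟩
  -- `t ∈ Z(γ)`: the torus is abelian
  have hcomm : ∀ k : «local» L (IsCMField.complexConj L) 3 (qsForm L) v, k ∈ (cmBorelTriple L 3 v).M → k * γ = γ * k := by
    intro k hk
    obtain ⟨d₁, hd₁⟩ := (mem_torusU_iff _).1 hγT
    obtain ⟨d₂, hd₂⟩ := (mem_torusU_iff _).1 hk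
    apply Subtype.ext
    rw [Subgroup.coe_mul, Subgroup.coe_mul, ← hd₁, ← hd₂, ← map_mul, ← map_mul, mul_comm]
  have htZ : (t.1 : «local» L (IsCMField.complexConj L) 3 (qsForm L) v) ∈
      Subgroup.centralizer ({γ} : Set («local» L (IsCMField.complexConj L) 3 (qsForm L) v)) :=
    Subgroup.mem_centralizer_singleton_iff.2 (hcomm t.1 t.2)
  obtain ⟨n, hn⟩ := hgen ⟨t.1, htZ⟩
  obtain ⟨K', hK'c, hmem⟩ := (mem_compactCore_iff _).1 hn
  -- trace the compact subgroup `K' ≤ Z(γ)` on the closed subgroup `T`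
  let KG : Subgroup («local» L (IsCMField.complexConj L) 3 (qsForm L) v) :=
    K'.map (Subgroup.centralizer ({γ} : Set («local» L (IsCMField.complexConj L) 3 (qsForm L) v))).subtype
  have hKGc : IsCompact (KG : Set («local» L (IsCMField.complexConj L) 3 (qsForm L) v)) := by
    rw [Subgroup.coe_map]
    exact hK'c.image continuous_subtype_val
  let KT : Subgroup ↥(cmBorelTriple L 3 v).M := KG.comap ((cmBorelTriple L 3 v).M).subtype
  have hTcl := isClosed_torusU_of_t1Space (conjLocal L (IsCMField.complexConj L) v) (cmLocalForm L 3 v)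
  have hKTc : IsCompact (KT : Set ↥(cmBorelTriple L 3 v).M) := by
    have h := hTcl.isClosedEmbedding_subtypeVal.isCompact_preimage hKGc
    exact h
  have hx1 : (Subgroup.centralizer ({γ} : Set («local» L (IsCMField.complexConj L) 3 (qsForm L) v))).subtype (⟨t.1, htZ⟩ * (τ ^ n)⁻¹) ∈ KG :=
    Subgroup.mem_map_of_mem _ hmem
  have hval : (Subgroup.centralizer ({γ} : Set («local» L (IsCMField.complexConj L) 3 (qsForm L) v))).subtype (⟨t.1, htZ⟩ * (τ ^ n)⁻¹) =
      ((((cmBorelTriple L 3 v).M).subtype (t * ((⟨_, hτT⟩ : ↥(cmBorelTriple L 3 v).M) ^ n)⁻¹)) : «local» L (IsCMField.complexConj L) 3 (qsForm L) v) := by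
    simp only [Subgroup.coe_subtype, Subgroup.coe_mul, Subgroup.coe_inv, SubgroupClass.coe_zpow]
    rfl
  have hx2 : ((((cmBorelTriple L 3 v).M).subtype (t * ((⟨_, hτT⟩ : ↥(cmBorelTriple L 3 v).M) ^ n)⁻¹)) : «local» L (IsCMField.complexConj L) 3 (qsForm L) v) ∈ KG := by
    rw [← hval]
    exact hx1
  exact ⟨n, KT, hKTc, hx2⟩

/-! ## §2 Additive, locally-zero characters of `T(L⁺_v)`: values `n · β(τ)`, one line -/

/-- An additive map into `ℂ` sends integer powers to integer multiples. [cite: Brown1982, Ch. III §1 Exercise 2 p. 60] -/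
theorem additive_map_zpow {G : Type*} [Group G] (β : G → ℂ) (hβ : ∀ g h, β (g * h) = β g + β h) (g : G) (n : ℤ) :
    β (g ^ n) = n • β g := by
  have hinv : ∀ x : G, β x⁻¹ = -β x := fun x => by
    have h := hβ x⁻¹ x
    rw [inv_mul_cancel, Literature.Topology.Algebra.additive_map_one β hβ] at h
    linear_combination -h
  cases n with
  | ofNat k => rw [Int.ofNat_eq_natCast, zpow_natCast, Literature.Topology.Algebra.additive_map_pow β hβ, natCast_zsmul]
  | negSucc k =>
    rw [zpow_negSucc, hinv, Literature.Topology.Algebra.additive_map_pow β hβ, negSucc_zsmul]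

include hw in
/-- **VALUES OF A LOCALLY-ZERO ADDITIVE CHARACTER**: with `τ` and `n = n(t)` as in `exists_generator_mod_compact` (the SAME `n` for all `β`), every additive `β : T(L⁺_v) → ℂ`
vanishing on an open subgroup satisfies `β t = n · β τ` (it vanishes on every compact subgroup, ★ LC-ADDITIVE). [cite: Brown1982, Ch. III §1 Exercise 2 p. 60] [cite: BourbakiGT1, Ch. III §2 no. 1]
[cite: Tits1979, §1.2 pp. 31–32] -/
theorem additive_eq_zsmul_generator :
    ∃ τ : ↥(cmBorelTriple L 3 v).M, ∀ t : ↥(cmBorelTriple L 3 v).M, ∃ n : ℤ, ∀ β : ↥(cmBorelTriple L 3 v).M → ℂ,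
      (∀ m m', β (m * m') = β m + β m') → (∃ U : Subgroup ↥(cmBorelTriple L 3 v).M, IsOpen (U : Set ↥(cmBorelTriple L 3 v).M) ∧ ∀ m ∈ U, β m = 0) →
        β t = n • β τ := by
  obtain ⟨τ, hτ⟩ := exists_generator_mod_compact L v w hw
  refine ⟨τ, fun t => ?_⟩
  obtain ⟨n, K, hKc, hmem⟩ := hτ t
  refine ⟨n, fun β hβ hU => ?_⟩
  obtain ⟨U, hUo, hU⟩ := hU
  have hK : β (t * (τ ^ n)⁻¹) = 0 :=
    Literature.Topology.Algebra.eq_zero_on_compact_of_eq_zero_on_open β hβ K hKc U hUo hU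
      (fun k x hk hx => Literature.Topology.Algebra.torsionFree_of_charZero (k := ℂ) k x hk hx) _ hmem
  have ht : t = t * (τ ^ n)⁻¹ * τ ^ n := by rw [inv_mul_cancel_right]
  rw [ht, hβ, hK, zero_add, additive_map_zpow β hβ]

include hw in
/-- **ROW 68-R — «`hrank` AT THE DATUM»: THE LOCALLY-ZERO ADDITIVE CHARACTERS OF `T(L⁺_v)` FORM ONE LINE** (`v` non-split).  If `lam : T → ℂ` is additive, vanishes on an open
subgroup `Kl` and is not identically zero, then every additive `β : T → ℂ` vanishing on an open subgroup is `c · lam` for one `c ∈ ℂ` — the binder `hrank` of ★ (O1)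
`F0P3cStCharTSK4PrimeJetIntertwiner.exists_jetIntertwiner_of_openCellJet` at `t := cmBorelTriple L 3 v`, in its exact shape after partial application.
(`β = n·β(τ)`, `lam = n·lam(τ)` with the same `n`, and `lam(τ) ≠ 0`.) [cite: Tits1979, §1.2 pp. 31–32] [cite: Rogawski1990, §1.10 p. 9; §3.6 p. 31] [cite: Brown1982, Ch. III §1 Exercise 2 p. 60] -/
theorem additive_eq_mul_of_eq_zero_on_open (lam : ↥(cmBorelTriple L 3 v).M → ℂ) (hlam : ∀ m m', lam (m * m') = lam m + lam m')
    (Kl : Subgroup ↥(cmBorelTriple L 3 v).M) (hKlo : IsOpen (Kl : Set ↥(cmBorelTriple L 3 v).M)) (hKl : ∀ m ∈ Kl, lam m = 0)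
    (hne : ∃ m, lam m ≠ 0) :
    ∀ β : ↥(cmBorelTriple L 3 v).M → ℂ, (∀ m m', β (m * m') = β m + β m') →
      (∃ U : Subgroup ↥(cmBorelTriple L 3 v).M, IsOpen (U : Set ↥(cmBorelTriple L 3 v).M) ∧ ∀ m ∈ U, β m = 0) →
        ∃ c : ℂ, ∀ m, β m = c * lam m := by
  intro β hβ hβU
  obtain ⟨τ, hτ⟩ := additive_eq_zsmul_generator L v w hw
  have hlamτ : lam τ ≠ 0 := by
    intro h0
    obtain ⟨m, hm⟩ := hne
    obtain ⟨n, hn⟩ := hτ m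
    exact hm (by rw [hn lam hlam ⟨Kl, hKlo, hKl⟩, h0, smul_zero])
  refine ⟨β τ * (lam τ)⁻¹, fun m => ?_⟩
  obtain ⟨n, hn⟩ := hτ m
  rw [hn β hβ hβU, hn lam hlam ⟨Kl, hKlo, hKl⟩, zsmul_eq_mul, zsmul_eq_mul]
  field_simp

/-! ## §3 (ED. 2, letter (L) for (M5)) The Weyl flip: every locally-zero additive character of `T(L⁺_v)` satisfies `λ(ʷt) = −λ(t)` -/

set_option maxHeartbeats 400000 in
include hw in
/-- **ED. 2 — LETTER (L) `hlamW` OF (M5) `exists_hGL_cmBorel` ∕ `hGLd_cmBorel`: THE WEYL FLIP `λ(w₀ t w₀⁻¹) = −λ(t)`** for EVERY additive `λ : T(L⁺_v) → ℂ` vanishing on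
an open subgroup (`v` non-split; `w₀ ∈ U(Φ₃)(L⁺_v)` the element with matrix `Φ₃`, ★ `weylConj_mem_cmTorus`).  The conclusion is the (M5) binder text token for token (the
redundant antecedent `lam 1 = 0` is kept so that the consumer docks by `exact`).  PROOF («the line `ℂ · ord_w` is `w`-odd»): the modulus witness
`ν(t) := log ‖t₀₀‖` (★ `unitModulusChar` ∘ ★ `torusEntry 0`) is additive, vanishes on the OPEN subgroup `{t : |t₀₀|_{w′} = 1 ∀ w′}` (★ `isOpen_setOf_forall_v_eq_one`,
★ `continuous_torusEntry`, ★ `unitModulusChar_eq_one_of_forall_v_eq_one`), is non-zero on the ray `e b = d(ϖ, 1, (σ_w ϖ)⁻¹)` (★ `exists_torus_coe_localNonsplitEquiv_eq_diagonal`,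
★ `unitModulusChar_torusEntry_lt_one_of_coe_localNonsplitEquiv_eq_diagonal`), and is `w`-ODD: `‖(ʷt)₀₀‖ = ‖t₀₀‖⁻¹` (★ T3b `unitModulusChar_torusEntry_zero_weylConj`); by §2
`additive_eq_mul_of_eq_zero_on_open` every locally-zero additive `λ` is `c · ν`, hence `w`-odd.  Budget `maxHeartbeats 400000` (2× default, §1's class; measured: the default
200000 times out at `isDefEq` on the CM carriers, 400000 passes, file wall ≈ 17 s). [cite: Tits1979, §1.2 pp. 31–32] [cite: Rogawski1990, §1.10 p. 9; §12.2 p. 173]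
[cite: Brown1982, Ch. III §1 Exercise 2 p. 60] -/
theorem additive_weylConj_eq_neg
    (w₀ : ↥(unitaryGroupOfForm (conjLocal L (IsCMField.complexConj L) v) (cmLocalForm L 3 v)))
    (hw₀ : Units.val (w₀ : GL (Fin 3) (LocalRing L v)) = cmLocalForm L 3 v) :
    ∀ lam : ↥(cmBorelTriple L 3 v).M → ℂ, lam 1 = 0 → (∀ m m', lam (m * m') = lam m + lam m') →
      (∃ U : Subgroup ↥(cmBorelTriple L 3 v).M, IsOpen (U : Set ↥(cmBorelTriple L 3 v).M) ∧ ∀ m ∈ U, lam m = 0) →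
        ∀ m : ↥(cmBorelTriple L 3 v).M,
          lam ⟨w₀ * (m : ↥(unitaryGroupOfForm (conjLocal L (IsCMField.complexConj L) v) (cmLocalForm L 3 v))) * w₀⁻¹,
              weylConj_mem_cmTorus L v w₀ hw₀ m⟩ = -lam m := by
  intro lam _ hlam hopen m
  -- the module of the first torus coordinate `t ↦ ‖t₀₀‖` is positive
  have hpos : ∀ t : ↥(cmBorelTriple L 3 v).M,
      (0 : ℝ) < ((unitModulusChar (LocalRing L v) (torusEntry (conjLocal L (IsCMField.complexConj L) v) (cmLocalForm L 3 v) 0 t) : NNReal) : ℝ) :=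
    fun t => NNReal.coe_pos.2 MeasureTheory.distribHaarChar_pos
  -- the modulus witness `ν(t) := log ‖t₀₀‖`
  set ν : ↥(cmBorelTriple L 3 v).M → ℂ := fun t =>
    ((Real.log ((unitModulusChar (LocalRing L v) (torusEntry (conjLocal L (IsCMField.complexConj L) v) (cmLocalForm L 3 v) 0 t) : NNReal) : ℝ) : ℝ) : ℂ) with hν
  have hνadd : ∀ t t' : ↥(cmBorelTriple L 3 v).M, ν (t * t') = ν t + ν t' := by
    intro t t'
    simp only [hν, map_mul, NNReal.coe_mul]
    rw [Real.log_mul (hpos t).ne' (hpos t').ne', Complex.ofReal_add]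
  -- its kernel contains the OPEN subgroup of integral first coordinates
  let U₁ : Subgroup (LocalRing L v)ˣ :=
    { carrier := {u | ∀ w' : PlacesOver L v, Valued.v ((u : LocalRing L v) w') = 1}
      mul_mem' := fun {a b} ha hb w' => by
        rw [Units.val_mul, Pi.mul_apply, map_mul, ha w', hb w', mul_one]
      one_mem' := fun w' => by rw [Units.val_one, Pi.one_apply, map_one]
      inv_mem' := fun {a} ha w' => by
        have h : Valued.v (((a⁻¹ : (LocalRing L v)ˣ) : LocalRing L v) w') * Valued.v ((a : LocalRing L v) w') = 1 := by
          rw [← map_mul, ← Pi.mul_apply, Units.inv_mul, Pi.one_apply, map_one]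
        rwa [ha w', mul_one] at h }
  let Kl : Subgroup ↥(cmBorelTriple L 3 v).M := U₁.comap (torusEntry (conjLocal L (IsCMField.complexConj L) v) (cmLocalForm L 3 v) 0)
  have hKlo : IsOpen (Kl : Set ↥(cmBorelTriple L 3 v).M) :=
    (isOpen_setOf_forall_v_eq_one L v).preimage (continuous_torusEntry (conjLocal L (IsCMField.complexConj L) v) (cmLocalForm L 3 v) 0)
  have hKl : ∀ t ∈ Kl, ν t = 0 := by
    intro t ht
    have h1 : unitModulusChar (LocalRing L v) (torusEntry (conjLocal L (IsCMField.complexConj L) v) (cmLocalForm L 3 v) 0 t) = 1 :=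
      unitModulusChar_eq_one_of_forall_v_eq_one L v _ ht
    simp only [hν, h1, NNReal.coe_one, Real.log_one, Complex.ofReal_zero]
  -- it is non-zero on the ray `e b = d(ϖ, 1, (σ_w ϖ)⁻¹)`
  obtain ⟨ϖ, hvϖ, -⟩ := TypeThreeTorus.exists_uniformizer L w hw
  have hϖ0 : ϖ ≠ 0 := fun h => by
    rw [h, map_zero] at hvϖ
    exact WithZero.exp_ne_zero hvϖ.symm
  have hϖ1 : Valued.v ϖ < 1 := by
    rw [hvϖ, ← WithZero.exp_zero]
    exact WithZero.exp_lt_exp.2 (by norm_num)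
  obtain ⟨b, hb⟩ := exists_torus_coe_localNonsplitEquiv_eq_diagonal L v w hw hϖ0
  have hb1 : unitModulusChar (LocalRing L v) (torusEntry (conjLocal L (IsCMField.complexConj L) v) (cmLocalForm L 3 v) 0 b) < 1 :=
    unitModulusChar_torusEntry_lt_one_of_coe_localNonsplitEquiv_eq_diagonal L v w hw hϖ1 b hb
  have hνb : ν b ≠ 0 := by
    have hlt : ((unitModulusChar (LocalRing L v) (torusEntry (conjLocal L (IsCMField.complexConj L) v) (cmLocalForm L 3 v) 0 b) : NNReal) : ℝ) < 1 := by
      exact_mod_cast hb1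
    have hlog : Real.log ((unitModulusChar (LocalRing L v) (torusEntry (conjLocal L (IsCMField.complexConj L) v) (cmLocalForm L 3 v) 0 b) : NNReal) : ℝ) < 0 :=
      Real.log_neg (hpos b) hlt
    simp only [hν, ne_eq, Complex.ofReal_eq_zero]
    exact hlog.ne
  -- it is `w`-odd: `‖(ʷt)₀₀‖ = ‖t₀₀‖⁻¹`
  have hνw : ν ⟨w₀ * (m : ↥(unitaryGroupOfForm (conjLocal L (IsCMField.complexConj L) v) (cmLocalForm L 3 v))) * w₀⁻¹,
      weylConj_mem_cmTorus L v w₀ hw₀ m⟩ = -ν m := by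
    letI : MeasurableSpace (LocalRing L v) := borel _
    haveI : BorelSpace (LocalRing L v) := ⟨rfl⟩
    have hflip : unitModulusChar (LocalRing L v) (torusEntry (conjLocal L (IsCMField.complexConj L) v) (cmLocalForm L 3 v) 0
        ⟨w₀ * (m : ↥(unitaryGroupOfForm (conjLocal L (IsCMField.complexConj L) v) (cmLocalForm L 3 v))) * w₀⁻¹,
          weylConj_mem_cmTorus L v w₀ hw₀ m⟩) = (unitModulusChar (LocalRing L v) (torusEntry (conjLocal L (IsCMField.complexConj L) v) (cmLocalForm L 3 v) 0 m))⁻¹ :=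
      unitModulusChar_torusEntry_zero_weylConj (conjLocal L (IsCMField.complexConj L) v) (conjLocal_conjLocal_cm L v)
        (continuous_conjLocal L (IsCMField.complexConj L) v) (cmLocalForm_eq_over L 3 v) w₀ hw₀ m
    simp only [hν, hflip, NNReal.coe_inv, Real.log_inv, Complex.ofReal_neg]
  -- §2: `lam = c · ν`, hence `lam` is `w`-odd
  obtain ⟨c, hc⟩ := additive_eq_mul_of_eq_zero_on_open L v w hw ν hνadd Kl hKlo hKl ⟨b, hνb⟩ lam hlam hopen
  rw [hc ⟨_, weylConj_mem_cmTorus L v w₀ hw₀ m⟩, hνw, hc m]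
  ring

end Summit.HodgeConjecture.HodgeConjecture.Cruxes.H413.F0P3cStCharTSAdditiveCharLine

end
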